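import Summits.Ventures.CertifiedQuantumChemistry.Rows.HubbardRingTVZeroHopping
import Summits.Ventures.CertifiedQuantumChemistry.Rows.HubbardRingTVDoublonSupergradient
import Summits.Ventures.CertifiedQuantumChemistry.Rows.StrongCouplingDegreeBound
import Summits.Ventures.CertifiedQuantumChemistry.Rows.StrongCouplingBookkeeping
import Summits.Ventures.CertifiedQuantumChemistry.Rows.OneBodySectorExactness
import Literature.MathematicalPhysics.QuantumChemistry.SectorRayleighRitz
import HarnessLib

/-!
# Ventures/CertifiedQuantumChemistry — Rows/HubbardRingTVWeakCoupling.lean: the WEAK-COUPLING side of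
# the TV-H picture — `E₀` and `OPT_X` are non-decreasing and `min(N_α, N_β)`-Lipschitz in `U`, both
# relaxations are EXACT at `U = 0`, and `0 ≤ E₀ − OPT_X ≤ U·min(N_α, N_β)`

HONEST FRAMING (verbatim): certified bounds for a stated model Hamiltonian in a stated basis; not a
claim about the real molecule beyond that model.

Seat rdm-B, ROWS courtesy file (theorems only; no `def`, no notation, no instance; zero compute): the
`U`-side companion of `Rows/HubbardRingTVZeroHopping.lean` (exactness at `t = 0`) on the cell's model
`hubbardRingTV L t U` (`E₀ = Model.energy`, `OPT_DQG = Model.pqgSectorEnergy`, `OPT_DQG+S² =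
Model.pqgSingletEnergy`; STRUCTURE §2 / §2.2.8). Gen 36's `Rows/HubbardRingTVDoublonSupergradient.lean`
typed the relaxation side in `U` (Danskin: `OPT_X` non-decreasing, the optimal doublon weight a
supergradient); this file adds the EXACT side (Feynman–Hellmann, pointwise: the ground state of `U` as
trial state at `U′`, its reduced density matrices as the feasible witness) and the one a-priori bound
that was missing — on ANY sector-feasible pair the total doublon weight is `≤ min(N_α, N_β)` (the
`G`-diagonal `γ_{p↑,p↑} − d_p ≥ 0`, summed) — and draws the consequences:

* §1 (abstract `Λ`) `WeakCoupling.sum_doublon_re_le_up/_down/_min/_of_singlet`: `Σ_p Re d_p ≤ min(a, b)`.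
* §2 EXACT ENERGY IN `U` (every `t`, `a, b ≤ L`): `hubbardRingTV_energy_le_add_mul_groundDoublon`
  (`E₀(U′) ≤ E₀(U) + (U′ − U)·s`, `s ∈ [0, min(a,b)]` a ground-state doublon weight at `U`); hence
  **`hubbardRingTV_energy_mono`** (`U ≤ U′ ⇒ E₀(U) ≤ E₀(U′)`), **`hubbardRingTV_energy_le_add_mul_min`**
  (`E₀(U′) ≤ E₀(U) + (U′ − U)·min(a, b)`), `abs_hubbardRingTV_energy_sub_le_min` (explicit Lipschitz
  constant `min(a, b)`, in place of `Σ_st ‖Ĥ(L;0,1)_st‖` of `Rows/SectorEnergyConcavity.lean`).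
* §3 RELAXATION VALUES IN `U`: `hubbardRingTV_pqgSectorEnergy_le_add_mul_min`,
  `hubbardRingTV_pqgSingletEnergy_le_add_mul` (the same one-sided bounds: supergradient + §1).
* §4 **EXACT AT `U = 0`**: `hubbardRingTV_pqgSectorEnergy_zero_repulsion` (`OPT_DQG(L; t, 0; a, b) =
  E₀(L; t, 0; a, b)`, all `a, b ≤ L`: one-body exactness, the two-electron table being `0`);
  `hubbardRingTV_pqgSingletEnergy_le_energy` (`OPT_DQG+S² ≤ E₀(n, n)` for EVERY `t`, `U > 0`: Lieb bridge /
  gen 37 at `t = 0`); **`hubbardRingTV_pqgSingletEnergy_zero_repulsion`** (`OPT_DQG+S²(2n; t, 0; n) =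
  E₀(2n; t, 0; n, n)` — no singlet witness needed: `OPT(0) ≤ OPT(U) ≤ E₀(U) ≤ E₀(0) + nU`, all `U > 0`).
* §5 **THE WEAK-COUPLING ENVELOPE** (`U ≥ 0`, every `t`): `0 ≤ E₀ − OPT_DQG ≤ U·min(a, b)`
  (`hubbardRingTV_gap_sector_mem_Icc`), `0 ≤ E₀(n, n) − OPT_DQG+S² ≤ U·n` (`…_singlet_…`); in the
  CONJECTURE LEAF's spelling (`t = 1`): `ĉ_X(2n; U) ≤ n·U²/4`, and with gen 36's degree bound
  `0 ≤ ĉ_X(2n; U) ≤ min(n·U²/4, 8n)` for all `U > 0` (`scaledGap_*_le_weak`, `scaledGap_*_mem_Icc_min`).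
  With the zero-hopping file and positive homogeneity, BOTH ENDS of the `t/U` axis are typed as exact;
  nothing is claimed in between, about monotonicity of the gap, or about any `U → ∞` limit.

READING: statements about the ABSTRACT programme values and the exact energy of the cell's own model
object; no certificate, row, hint, claim node or value of record depends on them. All PROVED (0 sorry,
standard axioms); no definitions, no named facts. References (docstring-only): R. P. Feynman, Phys. Rev.
56 (1939) 340 (variational slope); D. A. Mazziotti, Adv. Chem. Phys. 134 (2007) ch. 3 §II.B eq. (15),
§II.E.3 (i); E. H. Lieb, PRL 62 (1989) 1201 Thm 2 (via the tree's bridge); M. Nakata et al., J. Chem.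
Phys. 128 (2008) 164113 §II.C. Tree (REUSED): `exists_unit_eigen_sectorGroundEnergy`,
`sectorGroundEnergy_le_re_rayleigh_of_unit`, `rdmEnergy_rdm`, `IsDQGFeasibleSector.of_state`,
`two_diag_re_le_one_diag_re`, `StrongCouplingDoublon.hubbardRingTV_re_rdmEnergy_eq_add` /
`…_le_add_mul_doublon` / `…_mono`, `exists_isDQGFeasible{Sector,Singlet}_rdmEnergy_eq_…`,
`pqgSectorEnergy_eq_sectorGroundEnergy_oneBody`, `pqgSingletEnergy_le_minEnergyOn_singlet`,
`hubbardRingTV_singletEnergy_eq_energy`, `hubbardRingTV_{pqgSingletEnergy,energy}_zero_hopping`,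
`StrongCouplingGap.scaledGap_*`. Mathlib: `exists_rat_btwn`, `le_of_forall_pos_le_add`.
-/

noncomputable section

namespace Summit.Ventures.CertifiedQuantumChemistry

open Matrix Finset
open Literature.MathematicalPhysics.QuantumLattice Literature.MathematicalPhysics.QuantumChemistry
open Summit.Ventures.CertifiedQuantumChemistry.Hamiltonians
open scoped ComplexOrder

/-! ## §1 The total doublon weight of a sector-feasible pair is at most `min(N_α, N_β)` -/

namespace WeakCoupling

section Abstract

variable {Λ : Type*} [LinearOrder Λ] [Fintype Λ]
variable {γ : Matrix (Orb Λ) (Orb Λ) ℂ} {Γ : Matrix (Orb Λ × Orb Λ) (Orb Λ × Orb Λ) ℂ}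

/-- **`Σ_p Re d_p ≤ N_α`** on every `(a, b)`-sector-feasible pair: the `G`-diagonal gives
`Re Γ_{(p↑,p↓),(p↑,p↓)} ≤ Re γ_{p↑,p↑}` (`two_diag_re_le_one_diag_re`) and `Tr γ_αα = a`. -/
theorem sum_doublon_re_le_up {a b : ℕ} (hf : IsDQGFeasibleSector a b γ Γ) :
    ∑ p : Λ, (Γ (orb p 0, orb p 1) (orb p 0, orb p 1)).re ≤ a := by
  have h2 := congrArg Complex.re hf.trace_up
  rw [Complex.re_sum, Complex.natCast_re] at h2
  exact (sum_le_sum fun p _ => two_diag_re_le_one_diag_re hf.dqg (orb p 0) (orb p 1)).trans h2.le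

/-- **`Σ_p Re d_p ≤ N_β`** likewise (`d_p = Γ_{(p↓,p↑),(p↓,p↑)}` by antisymmetry in both index pairs,
then the `G`-diagonal at `(p↓, p↑)` and `Tr γ_ββ = b`). -/
theorem sum_doublon_re_le_down {a b : ℕ} (hf : IsDQGFeasibleSector a b γ Γ) :
    ∑ p : Λ, (Γ (orb p 0, orb p 1) (orb p 0, orb p 1)).re ≤ b := by
  have h2 := congrArg Complex.re hf.trace_down
  rw [Complex.re_sum, Complex.natCast_re] at h2
  have hswap : ∀ p : Λ,
      Γ (orb p 0, orb p 1) (orb p 0, orb p 1) = Γ (orb p 1, orb p 0) (orb p 1, orb p 0) := by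
    intro p
    rw [hf.dqg.swap_fst (orb p 0) (orb p 1) (orb p 1, orb p 0),
      hf.dqg.swap_snd (orb p 0, orb p 1) (orb p 0) (orb p 1), neg_neg]
  calc ∑ p : Λ, (Γ (orb p 0, orb p 1) (orb p 0, orb p 1)).re
      = ∑ p : Λ, (Γ (orb p 1, orb p 0) (orb p 1, orb p 0)).re := by
        refine sum_congr rfl fun p _ => ?_
        rw [hswap p]
    _ ≤ ∑ p : Λ, (γ (orb p 1) (orb p 1)).re :=
        sum_le_sum fun p _ => two_diag_re_le_one_diag_re hf.dqg (orb p 1) (orb p 0)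
    _ = b := h2

/-- **`Σ_p Re d_p ≤ min(N_α, N_β)`** on every sector-feasible pair. -/
theorem sum_doublon_re_le_min {a b : ℕ} (hf : IsDQGFeasibleSector a b γ Γ) :
    ∑ p : Λ, (Γ (orb p 0, orb p 1) (orb p 0, orb p 1)).re ≤ min (a : ℝ) (b : ℝ) :=
  le_min (sum_doublon_re_le_up hf) (sum_doublon_re_le_down hf)

/-- The doublon weights of a sector-feasible pair are non-negative (`D ⪰ 0` diagonal). -/
theorem sum_doublon_re_nonneg {a b : ℕ} (hf : IsDQGFeasibleSector a b γ Γ) :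
    0 ≤ ∑ p : Λ, (Γ (orb p 0, orb p 1) (orb p 0, orb p 1)).re :=
  sum_nonneg fun p _ => (Complex.nonneg_iff.1 (hf.dqg.d_psd.diag_nonneg (i := (orb p 0, orb p 1)))).1

/-- Singlet form: `Σ_p Re d_p ≤ n` on every feasible pair of the singlet-restricted programme
(`N = 2n`, `N_α = N_β = n`). -/
theorem sum_doublon_re_le_of_singlet {n : ℕ} (hf : IsDQGFeasibleSinglet n γ Γ) :
    ∑ p : Λ, (Γ (orb p 0, orb p 1) (orb p 0, orb p 1)).re ≤ n :=
  sum_doublon_re_le_up hf.toIsDQGFeasibleSector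

end Abstract

end WeakCoupling

/-! ## §2 The exact sector energy of `hubbardRingTV L t U` as a function of `U` -/

section Exact

variable {L : ℕ}

/-- **FEYNMAN–HELLMANN, POINTWISE**: for every `t`, `a, b ≤ L`, `U, U′` there is `s ∈ [0, min(a, b)]` (the
total doublon weight of a ground state of `hubbardRingTV L t U` in the sector) with
`E₀(L; t, U′; a, b) ≤ E₀(L; t, U; a, b) + (U′ − U)·s` — the variational principle at `U′` with that ground
state as trial state, its reduced density matrices being sector-feasible (§1 bounds `s`). [folklore] -/
theorem hubbardRingTV_energy_le_add_mul_groundDoublon (t U U' : ℚ) {a b : ℕ} (ha : a ≤ L) (hb : b ≤ L) :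
    ∃ s : ℝ, 0 ≤ s ∧ s ≤ min (a : ℝ) (b : ℝ) ∧
      Model.energy (hubbardRingTV L t U') a b ≤
        Model.energy (hubbardRingTV L t U) a b + ((U' : ℝ) - U) * s := by
  have ha' : a ≤ Fintype.card (Fin L) := by rw [Fintype.card_fin]; exact ha
  have hb' : b ≤ Fintype.card (Fin L) := by rw [Fintype.card_fin]; exact hb
  obtain ⟨ψ, hψ, hψ1, hHψ⟩ :=
    exists_unit_eigen_sectorGroundEnergy (hubbardRingTV_hamiltonian_isHermitian L t U) ha' hb'
  have hf : IsDQGFeasibleSector a b (oneRDM ψ) (twoRDM ψ) := IsDQGFeasibleSector.of_state hψ hψ1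
  refine ⟨∑ p : Fin L, ((twoRDM ψ) (orb p 0, orb p 1) (orb p 0, orb p 1)).re,
    WeakCoupling.sum_doublon_re_nonneg hf, WeakCoupling.sum_doublon_re_le_min hf, ?_⟩
  -- the functional at the pair of `ψ`: at `U` it is `E₀(U)`, at `U′` it bounds `E₀(U′)` from above
  have hEU : (rdmEnergy (fun p q => ((hubbardRingTV L t U).h p q : ℂ))
      (fun p q r s => ((hubbardRingTV L t U).eri p q r s : ℂ))
      ((hubbardRingTV L t U).ecore : ℂ) (oneRDM ψ) (twoRDM ψ)).re = Model.energy (hubbardRingTV L t U) a b := by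
    rw [rdmEnergy_rdm _ _ _ hψ1, hHψ, dotProduct_smul, hψ1, smul_eq_mul, mul_one, Complex.ofReal_re]
    rfl
  have hEU' : Model.energy (hubbardRingTV L t U') a b ≤
      (rdmEnergy (fun p q => ((hubbardRingTV L t U').h p q : ℂ))
        (fun p q r s => ((hubbardRingTV L t U').eri p q r s : ℂ))
        ((hubbardRingTV L t U').ecore : ℂ) (oneRDM ψ) (twoRDM ψ)).re := by
    rw [rdmEnergy_rdm _ _ _ hψ1]
    exact sectorGroundEnergy_le_re_rayleigh_of_unit (hubbardRingTV_hamiltonian_isHermitian L t U') hψ hψ1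
  have hadd := StrongCouplingDoublon.hubbardRingTV_re_rdmEnergy_eq_add (γ := oneRDM ψ) (Γ := twoRDM ψ)
    t U U' hf.dqg.swap_fst hf.dqg.swap_snd
  rw [hadd, hEU] at hEU'
  exact hEU'

/-- **REPULSION NEVER LOWERS THE EXACT SECTOR ENERGY**: `U ≤ U′ ⇒ E₀(L; t, U; a, b) ≤ E₀(L; t, U′; a, b)`
(every `t`, `a, b ≤ L`) — the on-site term has non-negative expectation in the ground state at `U′`. [folklore] -/
theorem hubbardRingTV_energy_mono (t : ℚ) {U U' : ℚ} (hUU' : U ≤ U') {a b : ℕ} (ha : a ≤ L) (hb : b ≤ L) :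
    Model.energy (hubbardRingTV L t U) a b ≤ Model.energy (hubbardRingTV L t U') a b := by
  obtain ⟨s, hs0, -, h⟩ := hubbardRingTV_energy_le_add_mul_groundDoublon (L := L) t U' U ha hb
  have hd : (U : ℝ) - U' ≤ 0 := sub_nonpos.2 (by exact_mod_cast hUU')
  nlinarith

/-- **`E₀(L; t, U′; a, b) ≤ E₀(L; t, U; a, b) + (U′ − U)·min(a, b)`** for `U ≤ U′` (every `t`, `a, b ≤ L`):
the exact sector energy grows at most with slope `min(N_α, N_β)` in `U`. [folklore] -/
theorem hubbardRingTV_energy_le_add_mul_min (t : ℚ) {U U' : ℚ} (hUU' : U ≤ U') {a b : ℕ} (ha : a ≤ L)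
    (hb : b ≤ L) :
    Model.energy (hubbardRingTV L t U') a b ≤
      Model.energy (hubbardRingTV L t U) a b + ((U' : ℝ) - U) * min (a : ℝ) (b : ℝ) := by
  obtain ⟨s, -, hs1, h⟩ := hubbardRingTV_energy_le_add_mul_groundDoublon (L := L) t U U' ha hb
  have hd : 0 ≤ (U' : ℝ) - U := sub_nonneg.2 (by exact_mod_cast hUU')
  nlinarith

/-- **`E₀` IS `min(N_α, N_β)`-LIPSCHITZ IN `U`**: `|E₀(L; t, U; a, b) − E₀(L; t, U′; a, b)| ≤ |U − U′|·min(a, b)`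
(every `t`, `a, b ≤ L`). [folklore] -/
theorem abs_hubbardRingTV_energy_sub_le_min (t U U' : ℚ) {a b : ℕ} (ha : a ≤ L) (hb : b ≤ L) :
    |Model.energy (hubbardRingTV L t U) a b - Model.energy (hubbardRingTV L t U') a b| ≤
      |(U : ℝ) - U'| * min (a : ℝ) (b : ℝ) := by
  rw [abs_sub_le_iff]
  rcases le_total U U' with hle | hle
  · have h1 := hubbardRingTV_energy_mono (L := L) t hle ha hb
    have h2 := hubbardRingTV_energy_le_add_mul_min (L := L) t hle ha hb
    rw [abs_sub_comm, abs_of_nonneg (sub_nonneg.2 (by exact_mod_cast hle : (U : ℝ) ≤ U'))]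
    constructor <;> nlinarith [le_min (Nat.cast_nonneg (α := ℝ) a) (Nat.cast_nonneg (α := ℝ) b)]
  · have h1 := hubbardRingTV_energy_mono (L := L) t hle ha hb
    have h2 := hubbardRingTV_energy_le_add_mul_min (L := L) t hle ha hb
    rw [abs_of_nonneg (sub_nonneg.2 (by exact_mod_cast hle : (U' : ℝ) ≤ U))]
    constructor <;> nlinarith [le_min (Nat.cast_nonneg (α := ℝ) a) (Nat.cast_nonneg (α := ℝ) b)]

end Exact

/-! ## §3 The relaxation values in `U`: one-sided Lipschitz bounds with constant `min(N_α, N_β)` -/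

section Relaxation

variable {L : ℕ}

/-- **`OPT_DQG(L; t, U′; a, b) ≤ OPT_DQG(L; t, U; a, b) + (U′ − U)·min(a, b)`** for `U ≤ U′` (every `t`,
`a, b ≤ L`): the supergradient inequality at an optimal pair for `U` and §1 (with gen 36's `…_mono`:
`0 ≤ OPT_DQG(U′) − OPT_DQG(U) ≤ (U′ − U)·min(a, b)`). [folklore] -/
theorem hubbardRingTV_pqgSectorEnergy_le_add_mul_min (t : ℚ) {U U' : ℚ} (hUU' : U ≤ U') {a b : ℕ}
    (ha : a ≤ L) (hb : b ≤ L) :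
    Model.pqgSectorEnergy (hubbardRingTV L t U') a b ≤
      Model.pqgSectorEnergy (hubbardRingTV L t U) a b + ((U' : ℝ) - U) * min (a : ℝ) (b : ℝ) := by
  have ha' : a ≤ Fintype.card (Fin L) := by rw [Fintype.card_fin]; exact ha
  have hb' : b ≤ Fintype.card (Fin L) := by rw [Fintype.card_fin]; exact hb
  obtain ⟨γ, Γ, hf, hE⟩ := exists_isDQGFeasibleSector_rdmEnergy_eq_pqgSectorEnergy
    (fun p q => ((hubbardRingTV L t U).h p q : ℂ))
    (fun p q r s => ((hubbardRingTV L t U).eri p q r s : ℂ)) ((hubbardRingTV L t U).ecore : ℂ) ha' hb'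
  have h := StrongCouplingDoublon.hubbardRingTV_pqgSectorEnergy_le_add_mul_doublon t U U' hf hE
  have hs := WeakCoupling.sum_doublon_re_le_min hf
  have hd : 0 ≤ (U' : ℝ) - U := sub_nonneg.2 (by exact_mod_cast hUU')
  unfold Model.pqgSectorEnergy
  nlinarith

/-- **`OPT_DQG+S²(L; t, U′; n) ≤ OPT_DQG+S²(L; t, U; n) + (U′ − U)·n`** for `U ≤ U′` (every `t`, `n ≤ L`;
with gen 36's `…_mono`: `0 ≤ OPT_DQG+S²(U′) − OPT_DQG+S²(U) ≤ (U′ − U)·n`). [folklore] -/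
theorem hubbardRingTV_pqgSingletEnergy_le_add_mul (t : ℚ) {U U' : ℚ} (hUU' : U ≤ U') {n : ℕ} (hn : n ≤ L) :
    Model.pqgSingletEnergy (hubbardRingTV L t U') n ≤
      Model.pqgSingletEnergy (hubbardRingTV L t U) n + ((U' : ℝ) - U) * n := by
  have hn' : n ≤ Fintype.card (Fin L) := by rw [Fintype.card_fin]; exact hn
  obtain ⟨γ, Γ, hf, hE⟩ := exists_isDQGFeasibleSinglet_rdmEnergy_eq_pqgSingletEnergy
    (fun p q => ((hubbardRingTV L t U).h p q : ℂ))
    (fun p q r s => ((hubbardRingTV L t U).eri p q r s : ℂ)) ((hubbardRingTV L t U).ecore : ℂ) hn'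
  have h := StrongCouplingDoublon.hubbardRingTV_pqgSingletEnergy_le_add_mul_doublon t U U' hf hE
  have hs := WeakCoupling.sum_doublon_re_le_of_singlet hf
  have hd : 0 ≤ (U' : ℝ) - U := sub_nonneg.2 (by exact_mod_cast hUU')
  unfold Model.pqgSingletEnergy
  nlinarith

end Relaxation

/-! ## §4 Exactness of both relaxations at `U = 0` -/

section ZeroRepulsion

variable {L : ℕ}

/-- **THE `S_z`-SECTOR DQG RELAXATION IS EXACT AT `U = 0`**: `OPT_DQG(L; t, 0; a, b) = E₀(L; t, 0; a, b)`
for every `t` and `a, b ≤ L` — `hubbardRingTV L t 0` is one-body (two-electron table `0`) and the sector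
programme has no gap for one-body Hamiltonians (`pqgSectorEnergy_eq_sectorGroundEnergy_oneBody`). [folklore] -/
theorem hubbardRingTV_pqgSectorEnergy_zero_repulsion (L : ℕ) (t : ℚ) {a b : ℕ} (ha : a ≤ L) (hb : b ≤ L) :
    Model.pqgSectorEnergy (hubbardRingTV L t 0) a b = Model.energy (hubbardRingTV L t 0) a b := by
  have ha' : a ≤ Fintype.card (Fin L) := by rw [Fintype.card_fin]; exact ha
  have hb' : b ≤ Fintype.card (Fin L) := by rw [Fintype.card_fin]; exact hb
  have hg : (fun p q r s => ((hubbardRingTV L t 0).eri p q r s : ℂ)) = 0 := by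
    funext p q r s
    simp only [hubbardRingTV, Pi.zero_apply]
    split_ifs <;> push_cast <;> rfl
  have hh : ∀ p q : Fin L, star ((hubbardRingTV L t 0).h p q : ℂ) = ((hubbardRingTV L t 0).h q p : ℂ) :=
    fun p q => by rw [Complex.star_def, map_ratCast, (hubbardRingTV_isSymmetric L t 0).1 p q]
  have hn : star ((hubbardRingTV L t 0).ecore : ℂ) = ((hubbardRingTV L t 0).ecore : ℂ) := by
    rw [Complex.star_def, map_ratCast]
  unfold Model.pqgSectorEnergy Model.energy Model.hamiltonian
  rw [hg]
  exact pqgSectorEnergy_eq_sectorGroundEnergy_oneBody hh hn ha' hb'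

/-- **`OPT_DQG+S²(2n; t, U; n) ≤ E₀(2n; t, U; n, n)` FOR EVERY `t` AND `U > 0`** (`n ≥ 1`): below the
singlet energy, which equals the sector energy on the half-filled even ring (Lieb; the tree's bridge
`hubbardRingTV_singletEnergy_eq_energy`, `t ≠ 0`); at `t = 0` both sides are `0` (gen 37). [folklore] -/
theorem hubbardRingTV_pqgSingletEnergy_le_energy {n : ℕ} (hn : 1 ≤ n) (t : ℚ) {U : ℚ} (hU : 0 < U) :
    Model.pqgSingletEnergy (hubbardRingTV (2 * n) t U) n ≤ Model.energy (hubbardRingTV (2 * n) t U) n n := by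
  have hnk : n ≤ Fintype.card (Fin (2 * n)) := by rw [Fintype.card_fin]; omega
  rcases eq_or_ne t 0 with rfl | ht
  · rw [hubbardRingTV_pqgSingletEnergy_zero_hopping hn hU,
      hubbardRingTV_energy_zero_hopping (L := 2 * n) (by omega) hU.le (show n + n = 2 * n by ring)]
  · exact (pqgSingletEnergy_le_minEnergyOn_singlet _ _ _ hnk).trans
      (hubbardRingTV_singletEnergy_eq_energy (by omega) ht hU).le

/-- **THE SINGLET-RESTRICTED DQG RELAXATION IS EXACT AT `U = 0`** (`L = 2n`, `n ≥ 1`, every `t`):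
`OPT_DQG+S²(2n; t, 0; n) = E₀(2n; t, 0; n, n)`. `≥`: the sector's exactness; `≤` WITHOUT a singlet witness
at `U = 0`: `OPT_DQG+S²(0) ≤ OPT_DQG+S²(U) ≤ E₀(U) ≤ E₀(0) + n·U` for every rational `U > 0`. [folklore] -/
theorem hubbardRingTV_pqgSingletEnergy_zero_repulsion {n : ℕ} (hn : 1 ≤ n) (t : ℚ) :
    Model.pqgSingletEnergy (hubbardRingTV (2 * n) t 0) n = Model.energy (hubbardRingTV (2 * n) t 0) n n := by
  have hnk : n ≤ Fintype.card (Fin (2 * n)) := by rw [Fintype.card_fin]; omega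
  have hnL : n ≤ 2 * n := by omega
  refine le_antisymm ?_ ?_
  · refine le_of_forall_pos_le_add fun ε hε => ?_
    have hn0 : (0 : ℝ) < n := by exact_mod_cast hn
    obtain ⟨U, hU0, hUε⟩ := exists_rat_btwn (div_pos hε hn0)
    have hU : (0 : ℚ) < U := by exact_mod_cast hU0
    have h1 : Model.pqgSingletEnergy (hubbardRingTV (2 * n) t 0) n ≤
        Model.pqgSingletEnergy (hubbardRingTV (2 * n) t U) n :=
      StrongCouplingDoublon.hubbardRingTV_pqgSingletEnergy_mono t hU.le hnL
    have h2 := hubbardRingTV_pqgSingletEnergy_le_energy hn t hU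
    have h3 := hubbardRingTV_energy_le_add_mul_min (L := 2 * n) t hU.le hnL hnL
    have h4 : ((U : ℝ) - ((0 : ℚ) : ℝ)) * min (n : ℝ) (n : ℝ) ≤ ε := by
      rw [Rat.cast_zero, sub_zero, min_self]
      have := (lt_div_iff₀ hn0).1 hUε
      linarith
    linarith
  · rw [← hubbardRingTV_pqgSectorEnergy_zero_repulsion (2 * n) t hnL hnL]
    exact pqgSectorEnergy_le_pqgSingletEnergy _ _ _ hnk

end ZeroRepulsion

/-! ## §5 The weak-coupling envelope `0 ≤ E₀ − OPT_X ≤ U·min(N_α, N_β)` -/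

section Envelope

variable {L : ℕ}

/-- **THE WEAK-COUPLING ENVELOPE, SECTOR LEVEL**: for `U ≥ 0`, every `t`, `a, b ≤ L`,
`0 ≤ E₀(L; t, U; a, b) − OPT_DQG(L; t, U; a, b) ≤ U·min(a, b)` (`E₀(U) ≤ E₀(0) + U·min(a, b)` (§2),
`OPT_DQG(0) ≤ OPT_DQG(U)` (gen 36), `OPT_DQG(0) = E₀(0)` (§4)). [folklore] -/
theorem hubbardRingTV_gap_sector_mem_Icc (t : ℚ) {U : ℚ} (hU : 0 ≤ U) {a b : ℕ} (ha : a ≤ L) (hb : b ≤ L) :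
    Model.energy (hubbardRingTV L t U) a b - Model.pqgSectorEnergy (hubbardRingTV L t U) a b ∈
      Set.Icc (0 : ℝ) ((U : ℝ) * min (a : ℝ) (b : ℝ)) := by
  have ha' : a ≤ Fintype.card (Fin L) := by rw [Fintype.card_fin]; exact ha
  have hb' : b ≤ Fintype.card (Fin L) := by rw [Fintype.card_fin]; exact hb
  have h0 : Model.pqgSectorEnergy (hubbardRingTV L t U) a b ≤ Model.energy (hubbardRingTV L t U) a b :=
    pqgSectorEnergy_le_sectorGroundEnergy (hubbardRingTV_hamiltonian_isHermitian L t U) ha' hb'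
  have h1 := hubbardRingTV_energy_le_add_mul_min (L := L) t hU ha hb
  have h2 : Model.pqgSectorEnergy (hubbardRingTV L t 0) a b ≤ Model.pqgSectorEnergy (hubbardRingTV L t U) a b :=
    StrongCouplingDoublon.hubbardRingTV_pqgSectorEnergy_mono t hU ha hb
  have h3 := hubbardRingTV_pqgSectorEnergy_zero_repulsion L t ha hb
  rw [Rat.cast_zero, sub_zero] at h1
  exact ⟨sub_nonneg.2 h0, by linarith⟩

/-- **THE WEAK-COUPLING ENVELOPE, SINGLET LEVEL** (`L = 2n`, `n ≥ 1`, `U ≥ 0`, every `t`):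
`0 ≤ E₀(2n; t, U; n, n) − OPT_DQG+S²(2n; t, U; n) ≤ U·n`. [folklore] -/
theorem hubbardRingTV_gap_singlet_mem_Icc {n : ℕ} (hn : 1 ≤ n) (t : ℚ) {U : ℚ} (hU : 0 ≤ U) :
    Model.energy (hubbardRingTV (2 * n) t U) n n - Model.pqgSingletEnergy (hubbardRingTV (2 * n) t U) n ∈
      Set.Icc (0 : ℝ) ((U : ℝ) * n) := by
  have hnL : n ≤ 2 * n := by omega
  have h0 : Model.pqgSingletEnergy (hubbardRingTV (2 * n) t U) n ≤ Model.energy (hubbardRingTV (2 * n) t U) n n := by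
    rcases hU.eq_or_lt with h | h
    · rw [← h, hubbardRingTV_pqgSingletEnergy_zero_repulsion hn t]
    · exact hubbardRingTV_pqgSingletEnergy_le_energy hn t h
  have h1 := hubbardRingTV_energy_le_add_mul_min (L := 2 * n) t hU hnL hnL
  have h2 : Model.pqgSingletEnergy (hubbardRingTV (2 * n) t 0) n ≤
      Model.pqgSingletEnergy (hubbardRingTV (2 * n) t U) n :=
    StrongCouplingDoublon.hubbardRingTV_pqgSingletEnergy_mono t hU hnL
  have h3 := hubbardRingTV_pqgSingletEnergy_zero_repulsion hn t
  rw [Rat.cast_zero, sub_zero, min_self] at h1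
  exact ⟨sub_nonneg.2 h0, by linarith⟩

/-- **IN THE CONJECTURE LEAF'S SPELLING, SECTOR LEVEL** (`t = 1`, `L = 2n`, `n ≥ 1`, `U > 0`): the scaled
gap obeys `ĉ_DQG(2n; U) = (U/4)·(E₀ − OPT_DQG) ≤ n·U²/4` — it is squeezed to `0` as `U → 0⁺`. [folklore] -/
theorem scaledGap_sector_le_weak {n : ℕ} (hn : 1 ≤ n) {U : ℚ} (hU : 0 < U) :
    ((U : ℝ) / 4) * (Model.energy (hubbardRingTV (2 * n) 1 U) n n -
        Model.pqgSectorEnergy (hubbardRingTV (2 * n) 1 U) n n) ≤ n * (U : ℝ) ^ 2 / 4 := by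
  have hU' : (0 : ℝ) ≤ (U : ℝ) := by exact_mod_cast hU.le
  obtain ⟨-, h⟩ := hubbardRingTV_gap_sector_mem_Icc (L := 2 * n) 1 hU.le (show n ≤ 2 * n by omega)
    (show n ≤ 2 * n by omega)
  rw [min_self] at h
  calc ((U : ℝ) / 4) * (Model.energy (hubbardRingTV (2 * n) 1 U) n n -
        Model.pqgSectorEnergy (hubbardRingTV (2 * n) 1 U) n n)
      ≤ ((U : ℝ) / 4) * ((U : ℝ) * n) := mul_le_mul_of_nonneg_left h (by positivity)
    _ = n * (U : ℝ) ^ 2 / 4 := by ring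

/-- **… SINGLET LEVEL**: `ĉ_DQG+S²(2n; U) = (U/4)·(E₀(n, n) − OPT_DQG+S²) ≤ n·U²/4` (`n ≥ 1`, `U > 0`).
[folklore] -/
theorem scaledGap_singlet_le_weak {n : ℕ} (hn : 1 ≤ n) {U : ℚ} (hU : 0 < U) :
    ((U : ℝ) / 4) * (Model.energy (hubbardRingTV (2 * n) 1 U) n n -
        Model.pqgSingletEnergy (hubbardRingTV (2 * n) 1 U) n) ≤ n * (U : ℝ) ^ 2 / 4 := by
  have hU' : (0 : ℝ) ≤ (U : ℝ) := by exact_mod_cast hU.le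
  obtain ⟨-, h⟩ := hubbardRingTV_gap_singlet_mem_Icc hn 1 hU.le
  calc ((U : ℝ) / 4) * (Model.energy (hubbardRingTV (2 * n) 1 U) n n -
        Model.pqgSingletEnergy (hubbardRingTV (2 * n) 1 U) n)
      ≤ ((U : ℝ) / 4) * ((U : ℝ) * n) := mul_le_mul_of_nonneg_left h (by positivity)
    _ = n * (U : ℝ) ^ 2 / 4 := by ring

/-- **THE TWO ENVELOPES JOINED, SECTOR LEVEL**: `0 ≤ ĉ_DQG(2n; U) ≤ min(n·U²/4, 8n)` for every `U > 0`
(`n ≥ 1`; the `8n` is gen 36's `StrongCouplingGap.scaledGap_sector_le_linear`; nothing about `U → ∞`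
follows — NOT claimed). [folklore] -/
theorem scaledGap_sector_mem_Icc_min {n : ℕ} (hn : 1 ≤ n) {U : ℚ} (hU : 0 < U) :
    ((U : ℝ) / 4) * (Model.energy (hubbardRingTV (2 * n) 1 U) n n -
        Model.pqgSectorEnergy (hubbardRingTV (2 * n) 1 U) n n) ∈
      Set.Icc (0 : ℝ) (min (n * (U : ℝ) ^ 2 / 4) (8 * n)) := by
  obtain ⟨h0, -⟩ := StrongCouplingGap.scaledGap_sector_mem_Icc hn hU
  exact ⟨h0, le_min (scaledGap_sector_le_weak hn hU) (StrongCouplingGap.scaledGap_sector_le_linear hn hU)⟩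

/-- **THE TWO ENVELOPES JOINED, SINGLET LEVEL**: `0 ≤ ĉ_DQG+S²(2n; U) ≤ min(n·U²/4, 8n)` for every `U > 0`
(`n ≥ 1`). [folklore] -/
theorem scaledGap_singlet_mem_Icc_min {n : ℕ} (hn : 1 ≤ n) {U : ℚ} (hU : 0 < U) :
    ((U : ℝ) / 4) * (Model.energy (hubbardRingTV (2 * n) 1 U) n n -
        Model.pqgSingletEnergy (hubbardRingTV (2 * n) 1 U) n) ∈
      Set.Icc (0 : ℝ) (min (n * (U : ℝ) ^ 2 / 4) (8 * n)) := by
  obtain ⟨h0, -⟩ := StrongCouplingGap.scaledGap_singlet_mem_Icc hn hU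
  exact ⟨h0, le_min (scaledGap_singlet_le_weak hn hU) (StrongCouplingGap.scaledGap_singlet_le_linear hn hU)⟩

end Envelope

end Summit.Ventures.CertifiedQuantumChemistry

end
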